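import Summits.QuantumFields.YangMills.Theorems.BalabanUVNodesN07NormalisationSymOfRecord
import Summits.QuantumFields.YangMills.Theorems.BalabanUVNodesN07NormalisationCrossingEnds
import Summits.QuantumFields.YangMills.Theorems.BalabanUVNodesN07NormalisationDbarFrames
import Summits.QuantumFields.YangMills.Theorems.UnitScaleTiltProp8ChartIterSmall
import HarnessLib

/-!
# N07 [B11] (= [15] = [Balaban1985Variational]) Sect. F — MODULE 93′ (plan g93 WORD A3⁵ = ρ3 «φ-FORM», chart side (III) step 1): **THE READER IN THE SYMMETRIC CURRENCY** —
# under MODULE 87's `NrmSymOfRecord` (`R̄^{l}g = 1` on the cells of print's family `D″`, `g = h̄·w·u⁻¹`), the double-bar averages of the Landau copy `(U^u)♮` at EVERY constraint bond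
# `c : BondIdx D″` are the representative's `eml`-averages of `(U^{h̄w})♮` CONJUGATED BY `Ψ := S⁻¹·V` at the two ends — `V` UST's accumulated double-bar frames ([3] (97)), `S` print's
# sheared frames `shearRIter` ([3] (85)) — with NO frame factor at out-ends: in the `R̄` currency an out-end over a block of cells is normalised by one step of [3] (80) (MODULE 61)

Cell `pub-ymgap`, seat `pub-ymgap-dag-n07-e` g30 (FAN-OUT §N07 row s3; LANE OWNER of the K0 road chart side) — plan g93 WORD A3⁵ queue (III).  `--kind proof --supports
stmt-QuantumFields-20541 --as helper` (K0⁷); count-neutral; THEOREMS ONLY (0 `def`); §§1–3 generic `P`, `N ≥ 1`, any fine field `U` and fine gauge maps `u`, `gw`.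
[3] = [Balaban1985Averaging]; [15] = [Balaban1985Variational]; [PropII] = [Balaban1984PropagatorsII]; [I] = [Balaban1987RG1]; [6] = [Balaban1985RegularSpaces].

WHY.  Under ρ3 the ninth row of the N07 head's Thm-4 premise is `NrmSymOfRecord` (88″'s `NrmDbarWideOfRecord` rests): S3's gauge `u` is normalised in print's OWN currency, the block
averages `R̄^{l}g = 1` ([3] (78)–(81)) of `g = h̄·w·u⁻¹` on the cell sites of `D″ = □ ⊓ Ω(s)`.  The chart reads UST's double-bar averages `U̿^{(l)}(U^u)♮(c)`; by UST (92)
(`dbarIterU_gaugeActT_eq`) the effective gauge at a site `y` of level `l` is `θ(y) = (V_l y)⁻¹·u↾(y)`, and by [3] (84)∕(87) (`toMS_eq_shearRIter_inv`, axial tower of `U^{h̄w}` for the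
averaged contour datum) `u↾(y) = S_l(U^u)(y)·(h̄w)↾(y)` wherever `R̄^{l}g(y) = 1`.  Hence `θ(y) = Ψ_l(y)⁻¹·(h̄w)↾(y)`, `Ψ_l := S_l⁻¹·V_l`, and
`U̿^{(l)}(U^u)♮(c) = Ψ(c₋)⁻¹ · Ū^{(l)}_{eml}((U^{h̄w})♮)(c) · Ψ(c₊)` — at BOTH ends of EVERY `c : BondIdx D″`, because in the `R̄` currency an end that is not a cell lies over a block of
cells ((2.2) collar, MODULE 61 `lamSite_or_forall_block_of_lamBond_end`) and `R̄^{l}g = R̄(R̄^{l−1}g) = R̄(1) = 1` there (MODULE 61 `gaugeAvgIter_bondIdx_ends_eq_one`): ⚑ LOCATED-OUT-END-FRAME's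
frame factor does not arise and NO widening of the family is needed.  The price is `Ψ`: `‖Ψ − 1‖ = ‖V − S‖ ≤ φ_l`, the φ-letter of the (L1″) frame bridge (`…N07DbarFrameTowerBridge`).

WHAT IS PROVED (sorry-free; axioms standard).
* §1 ★ `toUT_toMS_eq_shear_mul` (generic `av`, `cd`, `𝓔`): under the axial tower of `(U^u)^{g}`, `g = gw·u⁻¹`, below `l ≤ m+K` and `R̄^{l}g(y) = 1`: `u↾(y) = S_l(U^u)(y)·gw↾(y)` in `M_N(ℂ)ˣ`;
  ★ `toUT_toMS_eq_shear_mul_twist` — the same with `ρ̄ := R̄^{l}g` DISPLAYED and NO normalisation hypothesis: `u↾ = S·ρ̄⁻¹·gw↾` (plan g93 (Q-φ) protocol: φ-a is `ρ̄ = 1`, φ-b is `‖ρ̄ − 1‖ ≤ ψ`).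
* §2 ★★ `dbar_eq_conj_eml` (UST algebra): for the accumulated frames `V` of `(U^u)♮` and a bond `b` of level `l` with §1's equation at both ends,
  `U̿^{(l)}(U^u)♮(b) = (V_l b₋)⁻¹·S(b₋) · Ū^{(l)}_{eml}((U^{gw})♮)(b) · (S(b₊)⁻¹·V_l b₊)`; ★ `dbar_eq_conj_eml_twist` — the twisted edition `…·ρ̄(b₋)⁻¹·Ū·ρ̄(b₊)·…`.
* §3 ★ `norm_conj3_sub_one_le` + `norm_inv_mul_toUT_sub_one_eq` ∕ `norm_toUT_inv_mul_sub_one_eq`: `‖Ψ(b₋)⁻¹·E·Ψ(b₊) − 1‖ ≤ r + (φ₁ + φ₂ + φ₁φ₂)(1 + r)` from `‖E − 1‖ ≤ r`,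
  `‖V − S‖ ≤ φ` at the ends (`V` unitary at `b₋`; `S` special unitary).
* §4 AT THE RECORD ★★★ `NrmSymOfRecord.dbar_eq_conj_rep_bondIdx`: under `NrmSymOfRecord F N Mc ρ ν M g K k s U j idx u A` and `Adm22 D″ R M_b` (`2L ≤ R·M_b + 1`; FILE D0's instance), for
  the witness `w` (residual, `symCd`-axial tower) and EVERY family `V` of accumulated frames of `(U^u)♮`: the displayed identity at every `c : BondIdx D″` with `gw := h̄·w`, `h` the top
  axial gauge of `M^j(U^w)` on print's window rooted at its centre, `S := shearRIter (avOfRecord F N K) symCd (loopAvgBlockOp expMeanLogSU) (U^u)`.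
HONEST SCOPE: identities of the formal objects (no smallness) + one norm inequality; nothing of [15]∕[3]∕[I] analysis; (c′) NOT closed here; `NrmSymOfRecord` is a displayed premise row
(CONDITIONAL); K0⁷ NOT closed; N07 NOT discharged; counts unmoved; one finite 𝕋⁴ programme at fixed ε — the route closes the conditional finite-𝕋⁴ rung `BalabanLadder.UV` ONLY; the YM
mass gap (Clay) is NOT proved by any of this; nothing continuum ∕ ℝ⁴ ∕ OS.  No `def`, no `instance`, no `notation`, no `sorry`.

References: [3] (8)–(11) p. 19, (78)–(81) p. 30, (84)–(88) p. 31, (92) p. 31, (97)–(100) p. 32; [15] (144) p. 300, (150)–(154) pp. 301–302, (160) p. 303; [PropII] (2.1)–(2.4) p. 224;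
[I] (0.4) p. 253, (0.10)–(0.11) p. 253; [6] p. 98, (1.29) p. 81, (1.131) p. 99.
-/

set_option autoImplicit false

noncomputable section

open scoped Matrix.Norms.L2Operator

namespace Summit.QuantumFields.YangMills.BalabanUVNodes.N07SymCurrencyReader

open Literature.MathematicalPhysics.QuantumFieldTheory.Balaban1983to89
open Literature.MathematicalPhysics.QuantumFieldTheory.Balaban1983to89.Node00
open T4Continuum (T4Family)
open T4AxialGaugeRooted (axialGaugeAt)
open B12GaugeOrbits021 (IsResidual)
open B15Eq177GaugeInvariance (blockLift)
open B16Sect1Backgrounds (toMS)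
open B6SectADomainsV1 (Domains)
open B6SectAOperatorsV1 (BondIdx)
open GaugeField (gaugeAct)
open ExpMeanLog (expMeanLogSU)
open B10Eq27TorusAxialLog (unitsField toUField suIncl gaugeActT gaugeActT_apply)
open B14DomainGeom (Pt)
open B8Eq131Cubes (tLo tHi ctr)
open Summit.QuantumFields.YangMills.Theorems.Prop8Chart (emlIterU emlIterU_gaugeActT norm_mul_three_sub_one_le)
open Summit.QuantumFields.YangMills.Theorems.Prop8ChartDoubleBar (vframeU dbarIterU dbarIterU_gaugeActT_eq)
open Summit.QuantumFields.YangMills.Theorems.FlatCubeOpsText (Adm22)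
open Summit.QuantumFields.YangMills.BalabanUVNodes.N07NormalisationDbarFrames (toUT unitsField_toUField_gaugeAct toUT_toMS_succ)
open Summit.QuantumFields.YangMills.BalabanUVNodes.N07NormalisationOfRecord (gaugeAct_rep_of_landau)
open Summit.QuantumFields.YangMills.BalabanUVNodes.N07NormalisationSymOfRecord (symCd symCd_hctr NrmSymOfRecord symTower_gaugeAct_blockLift)
open Summit.QuantumFields.YangMills.BalabanUVNodes.N07NormalisationCrossingEnds (gaugeAvgIter_bondIdx_ends_eq_one)

variable {P : Params} {N : ℕ} [NeZero N]

/-! ## §1  [3] (87) in `M_N(ℂ)ˣ`: `u↾ = S·gw↾` wherever `R̄^{l}(gw·u⁻¹) = 1` -/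

/-- ★ **`u↾(y) = S_l(U^u)(y) · gw↾(y)`** at a site `y` of level `l ≤ m+K` where `R̄^{l}g(y) = 1`, `g = gw·u⁻¹`, under the block-axial tower of the averages of `(U^u)^{g} = U^{gw}` below `l`
([3] (87) `toMS_eq_shearRIter_inv`, read in `M_N(ℂ)ˣ` through `toUT`).  Generic averaging `av`, contour datum `cd` (trivial at centres) and block operation `𝓔` (local on blocks).
[cite: Balaban1985Averaging, (84) p.30, (87) p.31; Balaban1985Variational, (152) p.301] -/
theorem toUT_toMS_eq_shear_mul (av : ∀ i, Averaging P i (SU N)) (cd : ∀ i, ContourData P i (SU N)) (𝓔 : ∀ i, Site P (i + 1) → (Site P i → SU N) → SU N)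
    (h𝓔 : ∀ (i : ℕ) (y : Site P (i + 1)) (f f' : Site P i → SU N), (∀ x, blockOf x = y → f x = f' x) → 𝓔 i y f = 𝓔 i y f')
    (hctr : ∀ (i : ℕ) (U : GaugeField P i (SU N)) (y : Site P (i + 1)), (cd i).holTo U y (emb y) = 1)
    (U : GaugeField P 0 (SU N)) (u gw : GaugeTransf P 0 (SU N)) {l : ℕ} (hl : l ≤ P.m + P.K)
    (hax : ∀ i < l, AxialGauge (cd i) (Averaging.iter av i (gaugeAct (fun x => gw x * (u x)⁻¹) (gaugeAct u U))))
    {y : Site P l} (h81 : gaugeAvgIter 𝓔 (fun x => gw x * (u x)⁻¹) l y = 1) :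
    toUT (toMS u l) y = toUT (shearRIter av cd 𝓔 (gaugeAct u U) l) y * toUT (toMS gw l) y := by
  have h87 : toMS gw l y * (toMS u l y)⁻¹ = (shearRIter av cd 𝓔 (gaugeAct u U) l y)⁻¹ :=
    toMS_eq_shearRIter_inv av cd 𝓔 h𝓔 hctr hl hax h81
  have hmul : toMS u l y = shearRIter av cd 𝓔 (gaugeAct u U) l y * toMS gw l y := by
    have h1 : toMS u l y = (toMS gw l y * (toMS u l y)⁻¹)⁻¹ * toMS gw l y := by group
    rw [h1, h87, inv_inv]
  show Unitary.toUnits (suIncl (toMS u l y)) = Unitary.toUnits (suIncl (shearRIter av cd 𝓔 (gaugeAct u U) l y)) * Unitary.toUnits (suIncl (toMS gw l y))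
  rw [hmul, map_mul, map_mul]

/-- ★ **THE TWISTED FORM, NO NORMALISATION HYPOTHESIS** (plan g93 (Q-φ) protocol, branch-independent): with the block average `ρ̄ := R̄^{l}g`, `g = gw·u⁻¹`, DISPLAYED,
`u↾(y) = S_l(U^u)(y) · ρ̄(y)⁻¹ · gw↾(y)` at EVERY site `y` of level `l ≤ m+K` under the axial tower alone ([3] (84) `gaugeAvgIter_eq_mul_shearRIter`); §1's equation is the case `ρ̄(y) = 1`
(φ-a), an up-to-ψ normalisation (φ-b) reads `‖ρ̄(y) − 1‖ ≤ ψ`. [cite: Balaban1985Averaging, (84) p.30, (87) p.31] -/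
theorem toUT_toMS_eq_shear_mul_twist (av : ∀ i, Averaging P i (SU N)) (cd : ∀ i, ContourData P i (SU N)) (𝓔 : ∀ i, Site P (i + 1) → (Site P i → SU N) → SU N)
    (h𝓔 : ∀ (i : ℕ) (y : Site P (i + 1)) (f f' : Site P i → SU N), (∀ x, blockOf x = y → f x = f' x) → 𝓔 i y f = 𝓔 i y f')
    (hctr : ∀ (i : ℕ) (U : GaugeField P i (SU N)) (y : Site P (i + 1)), (cd i).holTo U y (emb y) = 1)
    (U : GaugeField P 0 (SU N)) (u gw : GaugeTransf P 0 (SU N)) {l : ℕ} (hl : l ≤ P.m + P.K)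
    (hax : ∀ i < l, AxialGauge (cd i) (Averaging.iter av i (gaugeAct (fun x => gw x * (u x)⁻¹) (gaugeAct u U)))) (y : Site P l) :
    toUT (toMS u l) y = toUT (shearRIter av cd 𝓔 (gaugeAct u U) l) y * (toUT (gaugeAvgIter 𝓔 (fun x => gw x * (u x)⁻¹) l) y)⁻¹ * toUT (toMS gw l) y := by
  have h84 : gaugeAvgIter 𝓔 (fun x => gw x * (u x)⁻¹) l y = toMS gw l y * (toMS u l y)⁻¹ * shearRIter av cd 𝓔 (gaugeAct u U) l y :=
    gaugeAvgIter_eq_mul_shearRIter av cd 𝓔 h𝓔 hctr l hl hax y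
  have hmul : toMS u l y = shearRIter av cd 𝓔 (gaugeAct u U) l y * (gaugeAvgIter 𝓔 (fun x => gw x * (u x)⁻¹) l y)⁻¹ * toMS gw l y := by
    rw [h84]; group
  show Unitary.toUnits (suIncl (toMS u l y)) = Unitary.toUnits (suIncl (shearRIter av cd 𝓔 (gaugeAct u U) l y)) *
    (Unitary.toUnits (suIncl (gaugeAvgIter 𝓔 (fun x => gw x * (u x)⁻¹) l y)))⁻¹ * Unitary.toUnits (suIncl (toMS gw l y))
  rw [hmul]
  simp only [map_mul, map_inv]

/-! ## §2  UST (92) + §1: the double-bar averages of the Landau copy are the representative's `eml`-averages conjugated by `Ψ = S⁻¹·V` -/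

/-- ★★ **`U̿^{(l)}(U^u)♮(b) = (V_l b₋)⁻¹·S(b₋) · Ū^{(l)}_{eml}((U^{gw})♮)(b) · (S(b₊)⁻¹·V_l b₊)`** for the accumulated frames `V` of `(U^u)♮` (`V 0 = 1`,
`V (i+1) y = V i (emb y)·vframeU (U̿^{(i)}(U^u)♮) y`) and a bond `b` of level `l` at whose two ends `u↾ = S·gw↾` (§1) — UST (92) `dbarIterU_gaugeActT_eq` (effective gauge
`(V_l)⁻¹·u↾`) and the covariance (11) of the single-bar tower for `gw`.  Pure algebra in `M_N(ℂ)ˣ`. [cite: Balaban1985Averaging, (11) p.19, (87)–(88) p.31, (92) p.31, (97)–(99) p.32; Balaban1985Variational, (154) p.302] -/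
theorem dbar_eq_conj_eml (U : GaugeField P 0 (SU N)) (u gw : GaugeTransf P 0 (SU N)) {l : ℕ} (S : GaugeTransf P l (SU N))
    (V : (i : ℕ) → Site P i → (Matrix (Fin N) (Fin N) ℂ)ˣ) (hV0 : ∀ x, V 0 x = 1)
    (hVs : ∀ (i : ℕ) (y : Site P (i + 1)), V (i + 1) y = V i (emb y) * vframeU (dbarIterU i (unitsField (toUField (gaugeAct u U)))) y)
    (b : PBond P l) (hs : toUT (toMS u l) b.src = toUT S b.src * toUT (toMS gw l) b.src) (ht : toUT (toMS u l) b.tgt = toUT S b.tgt * toUT (toMS gw l) b.tgt) :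
    dbarIterU l (unitsField (toUField (gaugeAct u U))) b =
      (V l b.src)⁻¹ * toUT S b.src * emlIterU l (unitsField (toUField (gaugeAct gw U))) b * ((toUT S b.tgt)⁻¹ * V l b.tgt) := by
  have hUu : unitsField (toUField (gaugeAct u U)) = gaugeActT (toUT (toMS u 0)) (unitsField (toUField U)) := unitsField_toUField_gaugeAct u U
  have hVs' : ∀ (i : ℕ) (y : Site P (i + 1)), V (i + 1) y = V i (emb y) * vframeU (dbarIterU i (gaugeActT (toUT (toMS u 0)) (unitsField (toUField U)))) y := by
    intro i y; have h := hVs i y; rwa [hUu] at h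
  have h92 := dbarIterU_gaugeActT_eq (fun i => toUT (toMS u i)) (fun i y => toUT_toMS_succ u i y) (unitsField (toUField U)) V hV0 hVs' l
  have hrep : emlIterU l (unitsField (toUField (gaugeAct gw U))) = gaugeActT (toUT (toMS gw l)) (emlIterU l (unitsField (toUField U))) := by
    rw [unitsField_toUField_gaugeAct]
    exact emlIterU_gaugeActT (fun i => toUT (toMS gw i)) (fun i y => toUT_toMS_succ gw i y) (unitsField (toUField U)) l
  rw [hUu, h92, hrep, gaugeActT_apply, gaugeActT_apply]
  show (V l b.src)⁻¹ * toUT (toMS u l) b.src * emlIterU l (unitsField (toUField U)) b * ((V l b.tgt)⁻¹ * toUT (toMS u l) b.tgt)⁻¹ = _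
  rw [hs, ht]
  group

/-- ★ **THE TWISTED READING, NO NORMALISATION HYPOTHESIS**: with §1's twisted equation `u↾ = S·ρ̄⁻¹·gw↾` at the two ends (ρ̄ any level-`l` gauge map — in use `R̄^{l}(gw·u⁻¹)`),
`U̿^{(l)}(U^u)♮(b) = (V_l b₋)⁻¹·S(b₋)·ρ̄(b₋)⁻¹ · Ū^{(l)}_{eml}((U^{gw})♮)(b) · (ρ̄(b₊)·S(b₊)⁻¹·V_l b₊)`: the representative's averages twisted by `ρ̄` at the ends (a normalisation defect enters
through `ρ̄(b₋)`, `ρ̄(b₊)` only) and conjugated by `Ψ`. Pure algebra. [cite: Balaban1985Averaging, (11) p.19, (84) p.30, (88) p.31, (92) p.31, (97)–(99) p.32] -/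
theorem dbar_eq_conj_eml_twist (U : GaugeField P 0 (SU N)) (u gw : GaugeTransf P 0 (SU N)) {l : ℕ} (S ρb : GaugeTransf P l (SU N))
    (V : (i : ℕ) → Site P i → (Matrix (Fin N) (Fin N) ℂ)ˣ) (hV0 : ∀ x, V 0 x = 1)
    (hVs : ∀ (i : ℕ) (y : Site P (i + 1)), V (i + 1) y = V i (emb y) * vframeU (dbarIterU i (unitsField (toUField (gaugeAct u U)))) y)
    (b : PBond P l) (hs : toUT (toMS u l) b.src = toUT S b.src * (toUT ρb b.src)⁻¹ * toUT (toMS gw l) b.src)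
    (ht : toUT (toMS u l) b.tgt = toUT S b.tgt * (toUT ρb b.tgt)⁻¹ * toUT (toMS gw l) b.tgt) :
    dbarIterU l (unitsField (toUField (gaugeAct u U))) b =
      (V l b.src)⁻¹ * toUT S b.src * (toUT ρb b.src)⁻¹ * emlIterU l (unitsField (toUField (gaugeAct gw U))) b *
        (toUT ρb b.tgt * (toUT S b.tgt)⁻¹ * V l b.tgt) := by
  have hUu : unitsField (toUField (gaugeAct u U)) = gaugeActT (toUT (toMS u 0)) (unitsField (toUField U)) := unitsField_toUField_gaugeAct u U
  have hVs' : ∀ (i : ℕ) (y : Site P (i + 1)), V (i + 1) y = V i (emb y) * vframeU (dbarIterU i (gaugeActT (toUT (toMS u 0)) (unitsField (toUField U)))) y := by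
    intro i y; have h := hVs i y; rwa [hUu] at h
  have h92 := dbarIterU_gaugeActT_eq (fun i => toUT (toMS u i)) (fun i y => toUT_toMS_succ u i y) (unitsField (toUField U)) V hV0 hVs' l
  have hrep : emlIterU l (unitsField (toUField (gaugeAct gw U))) = gaugeActT (toUT (toMS gw l)) (emlIterU l (unitsField (toUField U))) := by
    rw [unitsField_toUField_gaugeAct]
    exact emlIterU_gaugeActT (fun i => toUT (toMS gw i)) (fun i y => toUT_toMS_succ gw i y) (unitsField (toUField U)) l
  rw [hUu, h92, hrep, gaugeActT_apply, gaugeActT_apply]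
  show (V l b.src)⁻¹ * toUT (toMS u l) b.src * emlIterU l (unitsField (toUField U)) b * ((V l b.tgt)⁻¹ * toUT (toMS u l) b.tgt)⁻¹ = _
  rw [hs, ht]
  group

/-! ## §3  The norm form: conjugation by `Ψ` costs `φ` at each end -/

section Norms

omit [NeZero N] in
/-- The inverse of a unit of `M_N(ℂ)` whose value is unitary has unitary value. [cite: Balaban1985Averaging, (110) p.34 (bookkeeping)] -/
theorem val_inv_mem_unitary {V : (Matrix (Fin N) (Fin N) ℂ)ˣ} (hVu : (V : Matrix (Fin N) (Fin N) ℂ) ∈ Matrix.unitaryGroup (Fin N) ℂ) :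
    ((V⁻¹ : (Matrix (Fin N) (Fin N) ℂ)ˣ) : Matrix (Fin N) (Fin N) ℂ) ∈ Matrix.unitaryGroup (Fin N) ℂ := by
  have h1 : ((V⁻¹ : (Matrix (Fin N) (Fin N) ℂ)ˣ) : Matrix (Fin N) (Fin N) ℂ) = star (V : Matrix (Fin N) (Fin N) ℂ) := by
    have hsV : star (V : Matrix (Fin N) (Fin N) ℂ) * (V : Matrix (Fin N) (Fin N) ℂ) = 1 := Matrix.mem_unitaryGroup_iff'.mp hVu
    calc ((V⁻¹ : (Matrix (Fin N) (Fin N) ℂ)ˣ) : Matrix (Fin N) (Fin N) ℂ)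
        = star (V : Matrix (Fin N) (Fin N) ℂ) * (V : Matrix (Fin N) (Fin N) ℂ) * ((V⁻¹ : (Matrix (Fin N) (Fin N) ℂ)ˣ) : Matrix (Fin N) (Fin N) ℂ) := by
          rw [hsV, one_mul]
      _ = star (V : Matrix (Fin N) (Fin N) ℂ) := by rw [mul_assoc, Units.mul_inv, mul_one]
  rw [h1]
  exact Unitary.star_mem hVu

/-- The value of `toUT g y` is unitary. [cite: Balaban1985Averaging, (19) p.21 (bookkeeping)] -/
theorem val_toUT_mem_unitary {l : ℕ} (g : GaugeTransf P l (SU N)) (y : Site P l) :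
    ((toUT g y : (Matrix (Fin N) (Fin N) ℂ)ˣ) : Matrix (Fin N) (Fin N) ℂ) ∈ Matrix.unitaryGroup (Fin N) ℂ :=
  Matrix.specialUnitaryGroup_le_unitaryGroup (g y).2

/-- `‖(V)⁻¹·S − 1‖ = ‖V − S‖` for a unit `V` with unitary value and `S = toUT g y`. [cite: Balaban1985Averaging, (110) p.34 (bookkeeping)] -/
theorem norm_inv_mul_toUT_sub_one_eq {l : ℕ} (g : GaugeTransf P l (SU N)) (y : Site P l) {V : (Matrix (Fin N) (Fin N) ℂ)ˣ}
    (hVu : (V : Matrix (Fin N) (Fin N) ℂ) ∈ Matrix.unitaryGroup (Fin N) ℂ) :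
    ‖((V⁻¹ * toUT g y : (Matrix (Fin N) (Fin N) ℂ)ˣ) : Matrix (Fin N) (Fin N) ℂ) - 1‖ =
      ‖(V : Matrix (Fin N) (Fin N) ℂ) - ((toUT g y : (Matrix (Fin N) (Fin N) ℂ)ˣ) : Matrix (Fin N) (Fin N) ℂ)‖ := by
  have h1 : ((V⁻¹ * toUT g y : (Matrix (Fin N) (Fin N) ℂ)ˣ) : Matrix (Fin N) (Fin N) ℂ) - 1 =
      ((V⁻¹ : (Matrix (Fin N) (Fin N) ℂ)ˣ) : Matrix (Fin N) (Fin N) ℂ) * (((toUT g y : (Matrix (Fin N) (Fin N) ℂ)ˣ) : Matrix (Fin N) (Fin N) ℂ) - (V : Matrix (Fin N) (Fin N) ℂ)) := by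
    rw [mul_sub, Units.val_mul, Units.inv_mul]
  rw [h1, CStarRing.norm_mem_unitary_mul _ (val_inv_mem_unitary hVu), norm_sub_rev]

/-- `‖S⁻¹·V − 1‖ = ‖V − S‖` for `S = toUT g y` (special unitary) and any unit `V`. [cite: Balaban1985Averaging, (110) p.34 (bookkeeping)] -/
theorem norm_toUT_inv_mul_sub_one_eq {l : ℕ} (g : GaugeTransf P l (SU N)) (y : Site P l) (V : (Matrix (Fin N) (Fin N) ℂ)ˣ) :
    ‖(((toUT g y)⁻¹ * V : (Matrix (Fin N) (Fin N) ℂ)ˣ) : Matrix (Fin N) (Fin N) ℂ) - 1‖ =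
      ‖(V : Matrix (Fin N) (Fin N) ℂ) - ((toUT g y : (Matrix (Fin N) (Fin N) ℂ)ˣ) : Matrix (Fin N) (Fin N) ℂ)‖ := by
  have h1 : (((toUT g y)⁻¹ * V : (Matrix (Fin N) (Fin N) ℂ)ˣ) : Matrix (Fin N) (Fin N) ℂ) - 1 =
      (((toUT g y)⁻¹ : (Matrix (Fin N) (Fin N) ℂ)ˣ) : Matrix (Fin N) (Fin N) ℂ) * ((V : Matrix (Fin N) (Fin N) ℂ) - ((toUT g y : (Matrix (Fin N) (Fin N) ℂ)ˣ) : Matrix (Fin N) (Fin N) ℂ)) := by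
    rw [mul_sub, Units.val_mul, Units.inv_mul]
  rw [h1, CStarRing.norm_mem_unitary_mul _ (val_inv_mem_unitary (val_toUT_mem_unitary g y))]

omit [NeZero N] in
/-- ★ **CONJUGATION BY `Ψ` COSTS `φ` AT EACH END**: `‖x·E·z − 1‖ ≤ r + (φ₁ + φ₂ + φ₁φ₂)·(1 + r)` from `‖x − 1‖ ≤ φ₁`, `‖E − 1‖ ≤ r`, `‖z − 1‖ ≤ φ₂` (UST `norm_mul_three_sub_one_le`, terms regrouped).
[cite: Balaban1985Averaging, (110) p.34] -/
theorem norm_conj3_sub_one_le {x E z : Matrix (Fin N) (Fin N) ℂ} {φ₁ φ₂ r : ℝ} (hx : ‖x - 1‖ ≤ φ₁) (hE : ‖E - 1‖ ≤ r) (hz : ‖z - 1‖ ≤ φ₂) :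
    ‖x * E * z - 1‖ ≤ r + (φ₁ + φ₂ + φ₁ * φ₂) * (1 + r) := by
  have h := norm_mul_three_sub_one_le hx hE hz
  have : φ₁ + r + φ₂ + φ₁ * r + r * φ₂ + φ₁ * φ₂ + φ₁ * r * φ₂ = r + (φ₁ + φ₂ + φ₁ * φ₂) * (1 + r) := by ring
  linarith

end Norms

/-! ## §4  At the record: the reading under `NrmSymOfRecord` on EVERY constraint bond of `D″` -/

section Record

variable {F : T4Family}

/-- ★★★ **THE SYMMETRIC-CURRENCY READING OF `U̿(U^u)♮` ON THE CHART's WHOLE INDEX SET.**  Under `NrmSymOfRecord F N Mc ρ ν M g K k s U j idx u A` and the (2.2)-admissibility of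
print's family `D″ = □ ⊓ Ω(s)` (`Adm22 D″ R M_b`, `2L ≤ R·M_b + 1` — FILE D0's instance at the knit): for the witness `w` (residual; `M^i(U^w)` `symCd`-axial, `i < j`) and EVERY family `V` of
accumulated double-bar frames of `(U^u)♮`, at EVERY `c : BondIdx D″`,
`U̿^{(j(c))}(U^u)♮(c) = (V c₋)⁻¹·S(c₋) · Ū^{(j(c))}_{eml}((U^{h̄w})♮)(c) · (S(c₊)⁻¹·V c₊)`, `S = S_{j(c)}(U^u)` print's sheared frames for the averaged contour datum, `h` the top axial gauge of
`M^j(U^w)` on print's window rooted at its centre.  Both ends: MODULE 61 (`R̄g = 1` at the ends of every constraint bond — cells by the premise, out-ends by one step of [3] (80) over a block of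
cells); then §1 and §2.  No smallness, no widening of the family.
[cite: Balaban1985Variational, (150)–(154) pp.301–302, (160) p.303; Balaban1985Averaging, (78)–(81) p.30, (84)–(88) p.31, (92) p.31, (97) p.32; Balaban1984PropagatorsII, (2.1)–(2.3) p.224; Balaban1987RG1, (0.11) p.253] -/
theorem NrmSymOfRecord.dbar_eq_conj_rep_bondIdx {Mc ρ : ℕ} {ν : Stage7Numerics} {M : ℕ} {g : ℕ → ℝ} {K k : ℕ} {s : SeqOfRecord F ν M g K k}
    {U : GaugeField (F.P K) 0 (SU N)} {j : ℕ} {idx : Pt (F.P K).d} {u : GaugeTransf (F.P K) 0 (SU N)} {A : PBond (F.P K) 0 → MatA N}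
    (hN : NrmSymOfRecord F N Mc ρ ν M g K k s U j idx u A) (hk : j ≤ (F.P K).m + (F.P K).K) {R Mb : ℕ}
    (hAdm : Adm22 (domainsMeet (cubeDomains (F.P K) (cornerP (F.P K) Mc ρ idx) (sideP (F.P K) Mc ρ) ρ j hk) (domainsOfSeq s.Ω j hk)) R Mb)
    (hRM : 2 * (F.P K).L ≤ R * Mb + 1)
    (V : (i : ℕ) → Site (F.P K) i → (Matrix (Fin N) (Fin N) ℂ)ˣ) (hV0 : ∀ x, V 0 x = 1)
    (hVs : ∀ (i : ℕ) (y : Site (F.P K) (i + 1)), V (i + 1) y = V i (emb y) * vframeU (dbarIterU i (unitsField (toUField (gaugeAct u U)))) y) :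
    ∃ w : GaugeTransf (F.P K) 0 (SU N), IsResidual j w ∧
      (∀ i < j, AxialGauge (symCd F N K i) (Averaging.iter (avOfRecord F N K) i (gaugeAct w U))) ∧
      ∀ c : BondIdx (domainsMeet (cubeDomains (F.P K) (cornerP (F.P K) Mc ρ idx) (sideP (F.P K) Mc ρ) ρ j hk) (domainsOfSeq s.Ω j hk)),
        dbarIterU (c.1.1 : ℕ) (unitsField (toUField (gaugeAct u U))) c.1.2 =
          (V (c.1.1 : ℕ) c.1.2.src)⁻¹ *
              toUT (shearRIter (avOfRecord F N K) (fun i => symCd F N K i) (loopAvgBlockOp expMeanLogSU) (gaugeAct u U) (c.1.1 : ℕ)) c.1.2.src *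
            emlIterU (c.1.1 : ℕ) (unitsField (toUField (gaugeAct (fun x => blockLift j (axialGaugeAt (Averaging.iter (avOfRecord F N K) j (gaugeAct w U))
              (tLo (cornerP (F.P K) Mc ρ idx) ρ) (tHi (cornerP (F.P K) Mc ρ idx) (sideP (F.P K) Mc ρ) ρ) (ctr (cornerP (F.P K) Mc ρ idx) (sideP (F.P K) Mc ρ))) x * w x) U))) c.1.2 *
            ((toUT (shearRIter (avOfRecord F N K) (fun i => symCd F N K i) (loopAvgBlockOp expMeanLogSU) (gaugeAct u U) (c.1.1 : ℕ)) c.1.2.tgt)⁻¹ *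
              V (c.1.1 : ℕ) c.1.2.tgt) := by
  obtain ⟨w, hres, hax, hnorm⟩ := hN
  refine ⟨w, hres, hax, fun c => ?_⟩
  -- names
  have hDk : (domainsMeet (cubeDomains (F.P K) (cornerP (F.P K) Mc ρ idx) (sideP (F.P K) Mc ρ) ρ j hk) (domainsOfSeq s.Ω j hk)).k ≤ j := by
    show min j j ≤ j
    exact min_le_left _ _
  have hcj : (c.1.1 : ℕ) ≤ j := ((domainsMeet _ _).le_of_lamBond c.2).trans hDk
  have hcK : (c.1.1 : ℕ) ≤ (F.P K).m + (F.P K).K := hcj.trans hk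
  -- MODULE 61: `R̄^{j(c)} g = 1` at BOTH ends of `c`, `g = h̄·w·u⁻¹`
  have hends := gaugeAvgIter_bondIdx_ends_eq_one expMeanLogSU _ (expMeanLogSU_E_one' N) hAdm hRM _
    (fun j' hj' y hy => hnorm hk j' (hj'.trans hDk) y hy) c
  -- the axial tower of `(U^u)^{g} = (U^w)^{h̄}` below `j(c)`
  have hax' : ∀ i < (c.1.1 : ℕ), AxialGauge (symCd F N K i)
      (Averaging.iter (avOfRecord F N K) i (gaugeAct (fun x => blockLift j (axialGaugeAt (Averaging.iter (avOfRecord F N K) j (gaugeAct w U))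
        (tLo (cornerP (F.P K) Mc ρ idx) ρ) (tHi (cornerP (F.P K) Mc ρ idx) (sideP (F.P K) Mc ρ) ρ) (ctr (cornerP (F.P K) Mc ρ idx) (sideP (F.P K) Mc ρ))) x * w x * (u x)⁻¹)
        (gaugeAct u U))) := by
    rw [gaugeAct_rep_of_landau]
    exact fun i hi => symTower_gaugeAct_blockLift F N K hk _ _ hax i (lt_of_lt_of_le hi hcj)
  -- §1 at both ends, §2
  exact dbar_eq_conj_eml U u _ _ V hV0 hVs c.1.2
    (toUT_toMS_eq_shear_mul (avOfRecord F N K) (fun i => symCd F N K i) (loopAvgBlockOp expMeanLogSU)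
      (fun i y f f' h => loopAvgBlockOp_local expMeanLogSU i y f f' h) (symCd_hctr F N K) U u _ hcK hax' hends.1)
    (toUT_toMS_eq_shear_mul (avOfRecord F N K) (fun i => symCd F N K i) (loopAvgBlockOp expMeanLogSU)
      (fun i y f f' h => loopAvgBlockOp_local expMeanLogSU i y f f' h) (symCd_hctr F N K) U u _ hcK hax' hends.2)

end Record

end Summit.QuantumFields.YangMills.BalabanUVNodes.N07SymCurrencyReader

end
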